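import Literature.Topology.FourManifolds.RealProjectiveSpaceCohomology
import Literature.AlgebraicTopology.SingularHomology.FiniteDeckTransfer
import Literature.AlgebraicTopology.SingularHomology.ModPBettiNumbers
import Literature.AlgebraicTopology.SingularHomology.RationalEulerCharacteristic
import Literature.AlgebraicTopology.SingularHomology.WuVanishingOfTube
import Literature.AlgebraicTopology.SingularHomology.CellsAttachmentEuler
import Literature.AlgebraicTopology.SingularHomology.IntersectionFormProofs

/-!
# Betti numbers of the real projective plane: `rank H₀ = 1`, `rank H₁ = rank H₂ = 0`

Support file (refuter, cdisprove seat of crux stmt-SmoothPoincare4-7842) for the compact witness of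
`NoGenusTwoDoor` minus non-degeneracy (`ℝP² × T²`, sequel files). For the tree's standard real
projective plane `RealProjectiveSpace 2 = 𝕊²/±1` (`RealProjectiveSpaceProofs.lean`) we PROVE:

* `finrank ℤ H₀(ℝP²; ℤ) = 1` (path connected, Hatcher Prop. 2.7);
* `H¹(ℝP²; ℚ) = 0`, hence `finrank ℤ H₁(ℝP²; ℤ) = 0`: the transfer of the antipodal double cover
  (`FiniteDeckTransfer`: `τ^* p^* = 2`) makes `p^* : H¹(ℝP²; ℚ) → H¹(𝕊²; ℚ) = 0` injective
  (Hatcher Prop. 3G.1), and `dim_ℚ H¹(X; ℚ) = rank H₁(X; ℤ)` (Hatcher Cor. 3A.6);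
* `dim H_k(ℝP²; 𝔽₂) = 1` for `k = 0, 1, 2` (from the tree's `Hᵏ(ℝPⁿ; 𝔽₂) = {0, ωᵏ}`, `ωᵏ ≠ 0`,
  Hatcher Thm. 3.19, and `H₂ = 𝔽₂·[ℝP²]₂`, Thm. 3.26), hence by the `𝔽₂` Euler characteristic of
  a closed manifold (`eulerChar_int_eq_eulerChar_zmod`, Hatcher §3.A Ex. 1) `χ(ℝP²) = 1` and
  `finrank ℤ H₂(ℝP²; ℤ) = finrank ℤ H₁(ℝP²; ℤ) = 0`;
* the rational Betti numbers `b₀ = 1`, `b₁ = b₂ = 0` (`bettiNumber_int_eq_rat`).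

Everything is proved from the tree; no named facts, no `sorry`, no new definitions.
-/

noncomputable section

-- the prescribed namespace `Summit.<P>.<Sub>.…` duplicates `SmoothPoincare4` (P = Sub)
set_option linter.dupNamespace false

open CategoryTheory Limits
open Literature.Topology.FourManifolds Literature.AlgebraicTopology.SingularHomology

namespace Summit.SmoothPoincare4.SmoothPoincare4.Theorems.NoGenusTwoDoor.Negative

/-- `Fintype.card ℤˣ = 2`. [folklore] -/
theorem card_units_int : Fintype.card ℤˣ = 2 := rfl

/-- **`H¹(ℝP²; ℚ) = 0`**: with the antipodal covering `p : 𝕊² → ℝP²` packaged as a finite regular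
(deck) covering with group `ℤˣ = {±1}` (Hatcher, Example 1.43), `p^* x ∈ H¹(𝕊²; ℚ) = 0`, so
`2 • x = τ^* p^* x = 0` (transfer, Hatcher Prop. 3G.1), and `2` is invertible in `ℚ`. [folklore] -/
theorem singularCohomology_one_rat_eq_zero (x : singularCohomology ℚ ℚ (RealProjectiveSpace 2) 1) :
    x = 0 := by
  letI := antipodalAction 2
  haveI := continuousConstSMul_antipodal 2
  let c : FiniteDeckCover ℤˣ (Metric.sphere (0 : EuclideanSpace ℝ (Fin (2 + 1))) 1)
      (RealProjectiveSpace 2) :=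
    { proj := ⟨RealProjectiveSpace.mk 2, (RealProjectiveSpace.contMDiff_mk 2).continuous⟩
      isCoveringMap_proj := (RealProjectiveSpace.antipodalCover 2).isCoveringMap_proj
      surjective_proj := RealProjectiveSpace.mk_surjective 2
      continuous_smul := fun g ↦ continuous_const_smul g
      proj_smul := fun g e ↦ by
        show RealProjectiveSpace.mk 2 (g • e) = RealProjectiveSpace.mk 2 e
        rcases Int.units_eq_one_or g with rfl | rfl
        · rw [one_smul]
        · rw [antipodalAction_neg_one_smul]
          exact (RealProjectiveSpace.mk_eq_mk_iff (-e) e).2 (Or.inr (neg_neg e).symm)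
      exists_smul_of_proj_eq := fun {e e'} h ↦ by
        rcases (RealProjectiveSpace.mk_eq_mk_iff e' e).1 h with h1 | h1
        · exact ⟨1, by rw [one_smul]; exact h1.symm⟩
        · refine ⟨-1, ?_⟩
          rw [antipodalAction_neg_one_smul, h1, neg_neg] }
  have hz : IsZero (singularCohomology ℚ ℚ (Metric.sphere (0 : EuclideanSpace ℝ (Fin (2 + 1))) 1) 1) :=
    isZero_singularCohomology_sphere_of_field ℚ (M := 2) (k := 1) one_ne_zero (by norm_num)
  haveI : Subsingleton (singularCohomology ℚ ℚ (Metric.sphere (0 : EuclideanSpace ℝ (Fin (2 + 1))) 1) 1) :=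
    ModuleCat.subsingleton_of_isZero hz
  have h0 : singularCohomology.map ℚ ℚ c.proj 1 x = 0 := Subsingleton.elim _ _
  have h2 := c.card_smul_eq_zero_of_map_eq_zero (R := ℚ) 1 h0
  rw [card_units_int, ← Nat.cast_smul_eq_nsmul ℚ] at h2
  have : x = (1 / 2 : ℚ) • (((2 : ℕ) : ℚ) • x) := by
    rw [smul_smul]; norm_num
  rw [this, h2, smul_zero]

/-- `H¹(ℝP²; ℚ)` is the zero module. [folklore] -/
theorem subsingleton_singularCohomology_one_rat : Subsingleton (singularCohomology ℚ ℚ (RealProjectiveSpace 2) 1) :=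
  ⟨fun x y => by rw [singularCohomology_one_rat_eq_zero x, singularCohomology_one_rat_eq_zero y]⟩

/-- **`rank H₁(ℝP²; ℤ) = 0`** (`dim_ℚ H¹(ℝP²; ℚ) = rank H₁(ℝP²; ℤ)`, Hatcher Cor. 3A.6). [folklore] -/
theorem finrank_singularHomology_one_RP2 : Module.finrank ℤ (singularHomology ℤ ℤ (RealProjectiveSpace 2) 1) = 0 := by
  haveI := subsingleton_singularCohomology_one_rat
  rw [← finrank_singularCohomology_rat_eq (RealProjectiveSpace 2) 1]
  exact Module.finrank_zero_of_subsingleton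

/-- **`rank H₀(ℝP²; ℤ) = 1`** (path connected). [folklore] -/
theorem finrank_singularHomology_zero_RP2 :
    Module.finrank ℤ (singularHomology ℤ ℤ (RealProjectiveSpace 2) 0) = 1 := by
  haveI := RealProjectiveSpace.pathConnectedSpace 2 (by norm_num)
  rw [finrank_singularHomology_zero_of_pathConnectedSpace (R := ℤ) (M := ℤ), Module.finrank_self]

/-! ### The `𝔽₂` Betti numbers and the Euler characteristic -/

/-- `dim Hᵏ(ℝP²; 𝔽₂) = 1` for `k < 2`: the module is `{0, ωᵏ}` with `ωᵏ ≠ 0`. [folklore] -/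
theorem finrank_singularCohomology_zmod_RP2 {k : ℕ} (hk : k < 2) :
    Module.finrank (ZMod 2) (singularCohomology (ZMod 2) (ZMod 2) (RealProjectiveSpace 2) k) = 1 := by
  have hne := RealProjectiveSpace.omegaPow_ne_zero 2 (by norm_num) (k := k) hk.le
  rw [finrank_eq_one_iff_of_nonzero' _ hne]
  intro w
  rcases RealProjectiveSpace.eq_zero_or_eq_omegaPow 2 (by norm_num) hk w with rfl | rfl
  · exact ⟨0, zero_smul _ _⟩
  · exact ⟨1, one_smul _ _⟩

/-- `dim Hₖ(ℝP²; 𝔽₂) = 1` for `k < 2` (duality over the field `𝔽₂`). [folklore] -/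
theorem finrank_singularHomology_zmod_RP2 {k : ℕ} (hk : k < 2) :
    Module.finrank (ZMod 2) (singularHomology (ZMod 2) (ZMod 2) (RealProjectiveSpace 2) k) = 1 := by
  have h := finrank_singularCohomology_eq_bettiNumber_of_field (ZMod 2) (RealProjectiveSpace 2) k
  rw [finrank_singularCohomology_zmod_RP2 hk] at h
  exact h.symm

/-- `dim H₂(ℝP²; 𝔽₂) = 1`: `H₂ = 𝔽₂ · [ℝP²]₂` (Hatcher Thm. 3.26) and `[ℝP²]₂ ≠ 0` because
`H²(ℝP²; 𝔽₂) ∋ ω² ≠ 0` would otherwise vanish by duality. [folklore] -/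
theorem finrank_singularHomology_zmod_RP2_two :
    Module.finrank (ZMod 2) (singularHomology (ZMod 2) (ZMod 2) (RealProjectiveSpace 2) 2) = 1 := by
  haveI := RealProjectiveSpace.pathConnectedSpace 2 (by norm_num)
  haveI : ConnectedSpace (RealProjectiveSpace 2) := inferInstance
  have hfund : modTwoFundamentalClass (RealProjectiveSpace 2) 2 ≠ 0 := by
    intro h0
    -- then `H₂(ℝP²; 𝔽₂) = 0`, hence `H²(ℝP²; 𝔽₂) = 0`, contradicting `ω² ≠ 0`
    have hall : ∀ z : singularHomology (ZMod 2) (ZMod 2) (RealProjectiveSpace 2) 2, z = 0 := fun z => by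
      obtain ⟨a, rfl⟩ := exists_eq_smul_modTwoFundamentalClass (X := RealProjectiveSpace 2) (m := 2) z
      rw [h0, smul_zero]
    haveI : Subsingleton (singularHomology (ZMod 2) (ZMod 2) (RealProjectiveSpace 2) 2) :=
      ⟨fun x y => by rw [hall x, hall y]⟩
    haveI : Subsingleton (singularHomology (ZMod 2) (ZMod 2) (RealProjectiveSpace 2) 2 →ₗ[ZMod 2] ZMod 2) :=
      inferInstance
    haveI : Subsingleton (singularCohomology (ZMod 2) (ZMod 2) (RealProjectiveSpace 2) 2) :=
      (kroneckerPairing_bijective_of_field (ZMod 2) (RealProjectiveSpace 2) 2).1.subsingleton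
    have hω := RealProjectiveSpace.omegaPow_ne_zero 2 (by norm_num) (k := 2) le_rfl
    exact hω (Subsingleton.elim _ _)
  rw [finrank_eq_one_iff_of_nonzero' _ hfund]
  intro w
  obtain ⟨a, rfl⟩ := exists_eq_smul_modTwoFundamentalClass (X := RealProjectiveSpace 2) (m := 2) w
  exact ⟨a, rfl⟩

/-- **`rank H₂(ℝP²; ℤ) = 0`**: the `𝔽₂` Euler characteristic of the closed 2-manifold `ℝP²` is
`1 − 1 + 1 = 1 = rank H₀ − rank H₁ + rank H₂ = 1 − 0 + rank H₂` (Hatcher §3.A Ex. 1). [folklore] -/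
theorem finrank_singularHomology_two_RP2 : Module.finrank ℤ (singularHomology ℤ ℤ (RealProjectiveSpace 2) 2) = 0 := by
  haveI : Fact (Nat.Prime 2) := ⟨Nat.prime_two⟩
  have h := eulerChar_int_eq_eulerChar_zmod (p := 2) 2 (RealProjectiveSpace 2)
  simp only [Finset.sum_range_succ, Finset.sum_range_zero] at h
  rw [finrank_singularHomology_zero_RP2, finrank_singularHomology_one_RP2,
    finrank_singularHomology_zmod_RP2 (show 0 < 2 by norm_num),
    finrank_singularHomology_zmod_RP2 (show 1 < 2 by norm_num),
    finrank_singularHomology_zmod_RP2_two] at h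
  push_cast at h
  omega

/-! ### Rational Betti numbers -/

/-- `b₀(ℝP²; ℚ) = 1`. [folklore] -/
theorem bettiNumber_rat_RP2_zero : bettiNumber ℚ (RealProjectiveSpace 2) 0 = 1 := by
  rw [← bettiNumber_int_eq_rat]; exact finrank_singularHomology_zero_RP2

/-- `b₁(ℝP²; ℚ) = 0`. [folklore] -/
theorem bettiNumber_rat_RP2_one : bettiNumber ℚ (RealProjectiveSpace 2) 1 = 0 := by
  rw [← bettiNumber_int_eq_rat]; exact finrank_singularHomology_one_RP2

/-- `b₂(ℝP²; ℚ) = 0`. [folklore] -/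
theorem bettiNumber_rat_RP2_two : bettiNumber ℚ (RealProjectiveSpace 2) 2 = 0 := by
  rw [← bettiNumber_int_eq_rat]; exact finrank_singularHomology_two_RP2

end Summit.SmoothPoincare4.SmoothPoincare4.Theorems.NoGenusTwoDoor.Negative

end
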